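import Mathlib
import HarnessLib
import Literature.MathematicalPhysics.StatisticalMechanics.LennardJonesClusters
import Literature.Geometry.DiscreteGeometry.FlyspeckL12
import Summits.AtomisticToContinuum.Crystallization.Theorems.ContactSaturationLadderQuasiTwelve

/-!
# `ContactSaturationLadder` / E₂ `TwelveGapTextureRung` (stmt-AtomisticToContinuum-31516): TIGHT WINDOWS FILL SPACE (`stub_windowFilling`)

Registered stub `stub_windowFilling` of the line «ElasticWindow» (skeleton v6) of
E₂ = `Summit.AtomisticToContinuum.Crystallization.Theses.ContactSaturationLadder.TwelveGapTextureRung`, PROVED here with the registered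
header verbatim (definition-free file; decomposition cell decomp-a2c, lens-1 «grading / quantitative ladder», g8).  Statement (pure
discrete geometry, no ground-state hypothesis): modulo the Flyspeck local annulus inequality `L12` (Literature fact `flyspeck_L12`,
carried as the hypothesis exactly as in the stub), if `ρ ≥ 9` and the doubled window `B(p,2ρ)` of a finite configuration contains no
`(1/60)`-loose particle (route predicate `UniformlyTight` negated, inlined) but at least one particle, then `(ρ−9)³ ≤ 64·#B(p,ρ)`.
Together with the companion file `ContactSaturationLadderWindowFloor.lean` (`stub_windowFloorOfFilling : FILL → window energy floor`)
this is v5's `stub_windowFloor` (the elastic window law at price `0`).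

Proof.  §1 ONE-SIDED KISSING FROM `L12` (`exists_inner_gt`): twelve `d`-separated contact neighbours in the shell `[d,(61/60)d]`
meet every closed hemisphere quantitatively — for every unit vector `u` some neighbour has `⟨y_l − y_k, u⟩ > d/4` (else the phantom
point `y_k + d·u` is `d`-separated from all twelve and, rescaled by `2/d`, `L12` gives `1 + 12·L(2·61/60) ≤ 12`, i.e. `12.23 ≤ 12`).
§2 DESCENT (`exists_closer`): hence a `(1/60)`-tight particle is never a nearest particle of a point at distance `≥ 4` from it.
§3 FILLING (`tight_filling`, `card_window_ge`): if the doubled window is allowance-free and meets the configuration, every point of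
`B̄(p,ρ−9)` is within `4` of a particle of `B(p,ρ)`, so `|B̄(0,ρ−9)| ≤ #B(p,ρ)·|B(0,4)|` (Lebesgue measure), i.e. `(ρ−9)³ ≤ 64·#B(p,ρ)`.
§4 (`sum_inv_pow_six_le_two_scale_idx`, for the companion file): `Σ_{k∈T} |q−y_k|⁻⁶ ≤ 250η⁻³ρ⁻³` for an `η`-separated family `T` at
distance `≥ ρ ≥ η` from `q` (indexed form; dyadic shells, proof adapted from the tree's `TwoScaleShellSums`).
-/

namespace Summit.AtomisticToContinuum.Crystallization.Theorems.ContactSaturationLadderWindowFilling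

open scoped BigOperators Classical
open MeasureTheory Metric
open Literature.MathematicalPhysics.StatisticalMechanics (card_le_of_separated_of_dist_le)
open Literature.Geometry.DiscreteGeometry (flyspeck_L12 halesL hales_h0)
open Summit.AtomisticToContinuum.Crystallization.Theorems.ContactSaturationLadderQuasiTwelve (hales_h0_val halesL_eq
  halesL_antitone)

/-! ## §1 One-sided kissing from `L12` -/

/-- **Every direction is met.**  If `S` holds at least twelve indices whose points lie in the shell `[d, (1+δ)d]` about `y k`
(`0 ≤ δ ≤ 1/60`) and are pairwise `≥ d` apart, then for every unit vector `u` some `l ∈ S` has `⟨y_l − y_k, u⟩ > d/4`.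
(Otherwise the phantom point `y_k + d·u` together with the twelve rescaled by `2/d` is a `2`-separated set in the annulus
`[2, 2.52]` of total Hales weight `≥ 1 + 12·(73/78) > 12`, contradicting `L12`.) -/
theorem exists_inner_gt (hL12 : flyspeck_L12) {N : ℕ} (y : Fin N → EuclideanSpace ℝ (Fin 3)) (k : Fin N)
    (S : Finset (Fin N)) {d δ : ℝ} (hd : 0 < d) (hδ0 : 0 ≤ δ) (hδ : δ ≤ 1 / 60)
    (hS : ∀ l ∈ S, d ≤ dist (y l) (y k) ∧ dist (y l) (y k) ≤ (1 + δ) * d)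
    (hsep : ∀ l ∈ S, ∀ l' ∈ S, l ≠ l' → d ≤ dist (y l) (y l'))
    (hcard : 12 ≤ S.card) (u : EuclideanSpace ℝ (Fin 3)) (hu : ‖u‖ = 1) :
    ∃ l ∈ S, d / 4 < inner ℝ (y l - y k) u := by
  by_contra hcon
  push Not at hcon
  set φ : Fin N → EuclideanSpace ℝ (Fin 3) := fun l => (2 / d) • (y l - y k) with hφ
  set a : EuclideanSpace ℝ (Fin 3) := (2 : ℝ) • u with ha
  have h2d : (0 : ℝ) < 2 / d := by positivity
  have hnorm : ∀ l, ‖φ l‖ = 2 / d * dist (y l) (y k) := by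
    intro l
    rw [hφ]
    simp only [norm_smul, Real.norm_eq_abs, abs_of_pos h2d, dist_eq_norm]
  have hdistφ : ∀ l l', dist (φ l) (φ l') = 2 / d * dist (y l) (y l') := by
    intro l l'
    rw [hφ]
    simp only [dist_smul₀, Real.norm_eq_abs, abs_of_pos h2d]
    congr 1
    rw [dist_eq_norm, dist_eq_norm]
    congr 1
    abel
  have hna : ‖a‖ = 2 := by
    rw [ha, norm_smul, Real.norm_eq_abs, abs_of_pos two_pos, hu, mul_one]
  -- the phantom is `2`-separated from the rescaled neighbours
  have hdista : ∀ l ∈ S, 2 ≤ dist (φ l) a := by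
    intro l hl
    have h1 := (hS l hl).1
    have hin := hcon l hl
    have hrw : φ l - a = (2 / d) • ((y l - y k) - d • u) := by
      rw [hφ, ha, smul_sub, smul_smul, div_mul_cancel₀ _ hd.ne']
    have hxk : d ≤ ‖y l - y k‖ := by rwa [← dist_eq_norm]
    have hsq : d ^ 2 ≤ ‖(y l - y k) - d • u‖ ^ 2 := by
      rw [norm_sub_sq_real, real_inner_smul_right, norm_smul, Real.norm_eq_abs, abs_of_pos hd, hu, mul_one]
      nlinarith [mul_le_mul hxk hxk hd.le (norm_nonneg _), mul_le_mul_of_nonneg_left hin hd.le]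
    have hge : d ≤ ‖(y l - y k) - d • u‖ := (pow_le_pow_iff_left₀ hd.le (norm_nonneg _) two_ne_zero).1 hsq
    rw [dist_eq_norm, hrw, norm_smul, Real.norm_eq_abs, abs_of_pos h2d]
    calc (2 : ℝ) = 2 / d * d := by field_simp
      _ ≤ 2 / d * ‖(y l - y k) - d • u‖ := by gcongr
  have haS : a ∉ S.image φ := by
    intro h
    obtain ⟨l, hl, hla⟩ := Finset.mem_image.1 h
    have := hdista l hl
    rw [hla, dist_self] at this
    linarith
  have hinj : Set.InjOn φ ↑S := by
    intro l hl l' hl' hll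
    by_contra hne
    have hsep' := hsep l hl l' hl' hne
    have h0 : dist (φ l) (φ l') = 0 := by rw [hll, dist_self]
    rw [hdistφ] at h0
    rcases mul_eq_zero.1 h0 with h | h
    · exact absurd h h2d.ne'
    · linarith
  set V : Finset (EuclideanSpace ℝ (Fin 3)) := insert a (S.image φ) with hV
  have hVsep : ∀ p ∈ V, ∀ q ∈ V, p ≠ q → 2 ≤ dist p q := by
    intro p hp q hq hpq
    rw [hV, Finset.mem_insert, Finset.mem_image] at hp hq
    rcases hp with rfl | ⟨l, hl, rfl⟩ <;> rcases hq with rfl | ⟨l', hl', rfl⟩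
    · exact absurd rfl hpq
    · rw [dist_comm]; exact hdista l' hl'
    · exact hdista l hl
    · have hll : l ≠ l' := fun h => hpq (by rw [h])
      rw [hdistφ]
      calc (2 : ℝ) = 2 / d * d := by field_simp
        _ ≤ 2 / d * dist (y l) (y l') := by gcongr; exact hsep l hl l' hl' hll
  have hVann : ∀ p ∈ V, 2 ≤ ‖p‖ ∧ ‖p‖ ≤ 2 * hales_h0 := by
    intro p hp
    rw [hales_h0_val]
    rw [hV, Finset.mem_insert, Finset.mem_image] at hp
    rcases hp with rfl | ⟨l, hl, rfl⟩
    · rw [hna]; constructor <;> norm_num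
    · rw [hnorm]
      obtain ⟨h1, h2⟩ := hS l hl
      constructor
      · calc (2 : ℝ) = 2 / d * d := by field_simp
          _ ≤ 2 / d * dist (y l) (y k) := by gcongr
      · calc 2 / d * dist (y l) (y k) ≤ 2 / d * ((1 + δ) * d) := by gcongr
          _ = 2 * (1 + δ) := by field_simp
          _ ≤ 2 * (63 / 50) := by nlinarith
  have hsum := hL12 V hVsep hVann
  rw [hV, Finset.sum_insert haS, Finset.sum_image hinj] at hsum
  have haL : halesL (‖a‖ / 2) = 1 := by rw [hna, halesL_eq]; norm_num
  have hnear : ∀ l ∈ S, (73 / 78 : ℝ) ≤ halesL (‖φ l‖ / 2) := by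
    intro l hl
    obtain ⟨h1, h2⟩ := hS l hl
    have hle : ‖φ l‖ / 2 ≤ 61 / 60 := by
      rw [hnorm]
      calc 2 / d * dist (y l) (y k) / 2 = dist (y l) (y k) / d := by field_simp
        _ ≤ (1 + δ) * d / d := by gcongr
        _ = 1 + δ := by field_simp
        _ ≤ 61 / 60 := by linarith
    calc (73 / 78 : ℝ) = halesL (61 / 60) := by rw [halesL_eq]; norm_num
      _ ≤ _ := halesL_antitone hle
  have hSsum : (12 : ℝ) * (73 / 78) ≤ ∑ l ∈ S, halesL (‖φ l‖ / 2) := by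
    have h1 := Finset.card_nsmul_le_sum S (fun l => halesL (‖φ l‖ / 2)) _ hnear
    rw [nsmul_eq_mul] at h1
    have hc : (12 : ℝ) ≤ S.card := by exact_mod_cast hcard
    nlinarith
  rw [haL] at hsum
  linarith

/-! ## §2 Descent: a tight particle is never nearest to a far point -/

/-- If `y k` carries twelve `d`-separated contact neighbours in `[d,(61/60)d]` (`3/4 ≤ d ≤ 6/5`, separation `d` among all
particles within `6` of `y k`), then for every point `q` at distance `≥ 4` from `y k` some particle is strictly closer to `q`. -/
theorem exists_closer (hL12 : flyspeck_L12) {N : ℕ} (y : Fin N → EuclideanSpace ℝ (Fin 3)) (k : Fin N) {d : ℝ}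
    (hd : 3 / 4 ≤ d) (hd' : d ≤ 6 / 5)
    (hsep : ∀ a b : Fin N, a ≠ b → dist (y a) (y k) ≤ 6 → dist (y b) (y k) ≤ 6 → d ≤ dist (y a) (y b))
    (h12 : 12 ≤ (Finset.univ.filter fun l => l ≠ k ∧ dist (y l) (y k) ≤ (1 + 1 / 60) * d).card)
    (q : EuclideanSpace ℝ (Fin 3)) (hq : 4 ≤ dist (y k) q) : ∃ l : Fin N, dist (y l) q < dist (y k) q := by
  set S := Finset.univ.filter (fun l => l ≠ k ∧ dist (y l) (y k) ≤ (1 + 1 / 60) * d) with hS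
  have hdpos : 0 < d := by linarith
  have hmemS : ∀ l ∈ S, l ≠ k ∧ dist (y l) (y k) ≤ (1 + 1 / 60) * d := fun l hl => (Finset.mem_filter.1 hl).2
  have hnear6 : ∀ l ∈ S, dist (y l) (y k) ≤ 6 := fun l hl => by nlinarith [(hmemS l hl).2]
  have hk6 : dist (y k) (y k) ≤ 6 := by rw [dist_self]; norm_num
  have hSd : ∀ l ∈ S, d ≤ dist (y l) (y k) ∧ dist (y l) (y k) ≤ (1 + 1 / 60) * d := fun l hl =>
    ⟨hsep l k (hmemS l hl).1 (hnear6 l hl) hk6, (hmemS l hl).2⟩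
  have hsepS : ∀ l ∈ S, ∀ l' ∈ S, l ≠ l' → d ≤ dist (y l) (y l') := fun l hl l' hl' hne =>
    hsep l l' hne (hnear6 l hl) (hnear6 l' hl')
  set m := dist (y k) q with hm
  have hmpos : 0 < m := by linarith
  set u : EuclideanSpace ℝ (Fin 3) := m⁻¹ • (q - y k) with hu
  have hqk : q - y k = m • u := by rw [hu, smul_smul, mul_inv_cancel₀ hmpos.ne', one_smul]
  have hun : ‖u‖ = 1 := by
    rw [hu, norm_smul, Real.norm_eq_abs, abs_of_pos (inv_pos.2 hmpos), ← dist_eq_norm, dist_comm, ← hm,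
      inv_mul_cancel₀ hmpos.ne']
  obtain ⟨l, hl, hin⟩ := exists_inner_gt hL12 y k S hdpos (by norm_num) le_rfl hSd hsepS h12 u hun
  refine ⟨l, ?_⟩
  have hr : dist (y l) (y k) ≤ (1 + 1 / 60) * d := (hSd l hl).2
  have hsq : dist (y l) q ^ 2 < m ^ 2 := by
    have h1 : dist (y l) q = ‖(y l - y k) - (q - y k)‖ := by
      rw [dist_eq_norm]; congr 1; abel
    rw [h1, norm_sub_sq_real, hqk, real_inner_smul_right, norm_smul, Real.norm_eq_abs, abs_of_pos hmpos, hun, mul_one,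
      ← dist_eq_norm]
    have hdd : dist (y l) (y k) ^ 2 ≤ ((1 + 1 / 60) * d) ^ 2 := by gcongr
    nlinarith
  exact lt_of_pow_lt_pow_left₀ 2 hmpos.le hsq

/-! ## §3 Filling of allowance-free doubled windows -/

/-- **Filling.**  If every particle of the doubled window `B(p,2ρ)` is `(1/60)`-tight (the route's `UniformlyTight`, spelled out) and
the doubled window meets the configuration, then every point of `B(p,ρ−9)` lies within `4` of a particle. -/
theorem tight_filling (hL12 : flyspeck_L12) {N : ℕ} (y : Fin N → EuclideanSpace ℝ (Fin 3)) (p : EuclideanSpace ℝ (Fin 3))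
    {ρ : ℝ}
    (hA : ∀ i : Fin N, dist (y i) p ≤ 2 * ρ → ∃ d : ℝ, 3 / 4 ≤ d ∧ d ≤ 6 / 5 ∧
      (∀ k l : Fin N, k ≠ l → dist (y k) (y i) ≤ 6 → dist (y l) (y i) ≤ 6 → d ≤ dist (y k) (y l)) ∧
      (∀ k : Fin N, dist (y k) (y i) ≤ 5 → 12 ≤ (Finset.univ.filter fun l => l ≠ k ∧ dist (y l) (y k) ≤ (1 + 1 / 60) * d).card))
    (hne : ∃ i : Fin N, dist (y i) p ≤ 2 * ρ) (q : EuclideanSpace ℝ (Fin 3)) (hq : dist q p ≤ ρ - 9) :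
    ∃ i : Fin N, dist (y i) q < 4 := by
  obtain ⟨i₀, hi₀⟩ := hne
  have hN : (Finset.univ : Finset (Fin N)).Nonempty := ⟨i₀, Finset.mem_univ _⟩
  have key : ∀ (z : EuclideanSpace ℝ (Fin 3)) (k : Fin N), (∀ i, dist (y k) z ≤ dist (y i) z) →
      dist (y k) p ≤ 2 * ρ → dist (y k) z < 4 := by
    intro z k hmin hk
    by_contra hge
    push Not at hge
    obtain ⟨d, hd1, hd2, hsep, h12⟩ := hA k hk
    have h12k := h12 k (by rw [dist_self]; norm_num)
    obtain ⟨l, hl⟩ := exists_closer hL12 y k hd1 hd2 hsep h12k z hge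
    exact absurd (hmin l) (not_le.2 hl)
  obtain ⟨k₀, -, hk₀⟩ := Finset.exists_min_image Finset.univ (fun i => dist (y i) p) hN
  have hk₀p : dist (y k₀) p ≤ 2 * ρ := (hk₀ i₀ (Finset.mem_univ _)).trans hi₀
  have hk₀4 : dist (y k₀) p < 4 := key p k₀ (fun i => hk₀ i (Finset.mem_univ _)) hk₀p
  obtain ⟨k₁, -, hk₁⟩ := Finset.exists_min_image Finset.univ (fun i => dist (y i) q) hN
  have h1 : dist (y k₁) q ≤ dist (y k₀) q := hk₁ k₀ (Finset.mem_univ _)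
  have h2 : dist (y k₀) q ≤ dist (y k₀) p + dist p q := dist_triangle _ _ _
  have h3 : dist p q = dist q p := dist_comm _ _
  have h4 := dist_triangle (y k₁) q p
  have hρ : dist q p ≤ ρ := by linarith [dist_nonneg (x := q) (y := p)]
  have hk₁p : dist (y k₁) p ≤ 2 * ρ := by linarith
  exact ⟨k₁, key q k₁ (fun i => hk₁ i (Finset.mem_univ _)) hk₁p⟩

/-- **Volume count.**  Under the hypotheses of `tight_filling` and `ρ ≥ 9`: `(ρ−9)³ ≤ 64 · #B(p,ρ)` (the `4`-balls about the window's
particles cover `B̄(p,ρ−9)`; Lebesgue volume). -/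
theorem card_window_ge (hL12 : flyspeck_L12) {N : ℕ} (y : Fin N → EuclideanSpace ℝ (Fin 3)) (p : EuclideanSpace ℝ (Fin 3))
    {ρ : ℝ} (hρ : 9 ≤ ρ)
    (hA : ∀ i : Fin N, dist (y i) p ≤ 2 * ρ → ∃ d : ℝ, 3 / 4 ≤ d ∧ d ≤ 6 / 5 ∧
      (∀ k l : Fin N, k ≠ l → dist (y k) (y i) ≤ 6 → dist (y l) (y i) ≤ 6 → d ≤ dist (y k) (y l)) ∧
      (∀ k : Fin N, dist (y k) (y i) ≤ 5 → 12 ≤ (Finset.univ.filter fun l => l ≠ k ∧ dist (y l) (y k) ≤ (1 + 1 / 60) * d).card))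
    (hne : ∃ i : Fin N, dist (y i) p ≤ 2 * ρ) :
    (ρ - 9) ^ 3 ≤ 64 * ((Finset.univ.filter fun i : Fin N => dist (y i) p ≤ ρ).card : ℝ) := by
  set W := Finset.univ.filter (fun i : Fin N => dist (y i) p ≤ ρ) with hW
  have hcov : closedBall p (ρ - 9) ⊆ ⋃ i ∈ W, ball (y i) 4 := by
    intro q hq
    rw [mem_closedBall] at hq
    obtain ⟨i, hi⟩ := tight_filling hL12 y p hA hne q hq
    have hiW : i ∈ W := by
      refine Finset.mem_filter.2 ⟨Finset.mem_univ _, ?_⟩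
      have := dist_triangle (y i) q p
      linarith
    exact Set.mem_biUnion hiW (by rw [mem_ball, dist_comm]; exact hi)
  have hfin : volume (⋃ i ∈ W, ball (y i) (4 : ℝ)) ≠ ⊤ := by
    refine (lt_of_le_of_lt (measure_biUnion_finset_le W fun i => ball (y i) (4 : ℝ)) ?_).ne
    rw [ENNReal.sum_lt_top]
    exact fun i _ => measure_ball_lt_top
  have hvol := measureReal_mono (μ := volume) hcov hfin
  have h1 : volume.real (closedBall p (ρ - 9)) = (ρ - 9) ^ 3 * volume.real (ball (0 : EuclideanSpace ℝ (Fin 3)) 1) := by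
    rw [Measure.addHaar_real_closedBall _ _ (by linarith), finrank_euclideanSpace_fin]
  have h2 : volume.real (⋃ i ∈ W, ball (y i) (4 : ℝ)) ≤ ∑ i ∈ W, volume.real (ball (y i) (4 : ℝ)) :=
    measureReal_biUnion_finset_le W _
  have h3 : ∀ i ∈ W, volume.real (ball (y i) (4 : ℝ)) = 4 ^ 3 * volume.real (ball (0 : EuclideanSpace ℝ (Fin 3)) 1) := by
    intro i _
    rw [← Measure.addHaar_real_closedBall_eq_addHaar_real_ball volume (y i) 4, Measure.addHaar_real_closedBall _ _ (by norm_num),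
      finrank_euclideanSpace_fin]
  rw [Finset.sum_congr rfl h3, Finset.sum_const, nsmul_eq_mul] at h2
  have hv : 0 < volume.real (ball (0 : EuclideanSpace ℝ (Fin 3)) 1) :=
    ENNReal.toReal_pos (measure_ball_pos volume _ one_pos).ne' measure_ball_lt_top.ne
  have h4 : (ρ - 9) ^ 3 * volume.real (ball (0 : EuclideanSpace ℝ (Fin 3)) 1)
      ≤ (64 * (W.card : ℝ)) * volume.real (ball (0 : EuclideanSpace ℝ (Fin 3)) 1) := by
    rw [h1] at hvol
    linarith only [hvol, h2]
  exact le_of_mul_le_mul_right h4 hv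

/-! ## §4 Two-scale shell sums (used by the companion energy file) -/

/-- **Two-scale shell sum, indexed form.**  If the points `y k`, `k ∈ T`, are pairwise `≥ η` apart and all at distance `≥ ρ ≥ η > 0`
from `q`, then `Σ_{k∈T} |q − y_k|⁻⁶ ≤ 250 η⁻³ ρ⁻³` (shells of width `ρ` about `q`; the `b`-th shell holds `≤ ((2b+3)ρ/η)³` points and
contributes `≤ 125 η⁻³ρ⁻³ b⁻²`; `Σ b⁻² ≤ 2`).  Proof adapted from the tree's point-set version
`TwoScaleShellSums.sum_inv_pow_six_le_two_scale`. -/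
theorem sum_inv_pow_six_le_two_scale_idx {N : ℕ} (y : Fin N → EuclideanSpace ℝ (Fin 3)) (T : Finset (Fin N))
    (q : EuclideanSpace ℝ (Fin 3)) {η ρ : ℝ} (hη : 0 < η) (hηρ : η ≤ ρ)
    (ht : ∀ k ∈ T, ∀ l ∈ T, k ≠ l → η ≤ dist (y k) (y l)) (hp : ∀ k ∈ T, ρ ≤ dist q (y k)) :
    ∑ k ∈ T, (dist q (y k))⁻¹ ^ 6 ≤ 250 * η⁻¹ ^ 3 * ρ⁻¹ ^ 3 := by
  classical
  have hinj : Set.InjOn y ↑T := by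
    intro k hk l hl hkl
    by_contra hne
    have h := ht k hk l hl hne
    rw [hkl, dist_self] at h
    exact absurd h (not_le.2 hη)
  have hsum : ∑ k ∈ T, (dist q (y k))⁻¹ ^ 6 = ∑ z ∈ T.image y, (dist q z)⁻¹ ^ 6 := by
    rw [Finset.sum_image hinj]
  rw [hsum]
  set t := T.image y with ht_def
  have ht' : ∀ z ∈ t, ∀ w ∈ t, z ≠ w → η ≤ dist z w := by
    intro z hz w hw hzw
    obtain ⟨k, hk, rfl⟩ := Finset.mem_image.1 hz
    obtain ⟨l, hl, rfl⟩ := Finset.mem_image.1 hw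
    exact ht k hk l hl (fun h => hzw (by rw [h]))
  have hp' : ∀ z ∈ t, ρ ≤ dist q z := by
    intro z hz
    obtain ⟨k, hk, rfl⟩ := Finset.mem_image.1 hz
    exact hp k hk
  have hρ : 0 < ρ := hη.trans_le hηρ
  set m : EuclideanSpace ℝ (Fin 3) → ℕ := fun z => ⌊dist q z / ρ⌋₊ with hm
  set u := t.image m with hu_def
  have hmem : ∀ z ∈ t, m z ∈ u := fun z hz => Finset.mem_image_of_mem m hz
  have hm1 : ∀ z ∈ t, 1 ≤ m z := fun z hz =>
    (Nat.one_le_floor_iff _).2 ((one_le_div hρ).2 (hp' z hz))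
  have hmle : ∀ z ∈ t, ρ * m z ≤ dist q z := fun z hz => by
    have := Nat.floor_le (div_nonneg dist_nonneg hρ.le : 0 ≤ dist q z / ρ)
    rwa [le_div_iff₀ hρ, mul_comm] at this
  have hmlt : ∀ z ∈ t, dist q z < (m z + 1) * ρ := fun z hz => by
    have := Nat.lt_floor_add_one (dist q z / ρ)
    rwa [div_lt_iff₀ hρ] at this
  have step1 : ∑ z ∈ t, (dist q z)⁻¹ ^ 6 ≤ ∑ z ∈ t, ρ⁻¹ ^ 6 * ((m z : ℝ))⁻¹ ^ 6 := by
    refine Finset.sum_le_sum fun z hz => ?_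
    rw [← mul_pow, ← mul_inv]
    have h0 : 0 < ρ * m z := mul_pos hρ (by exact_mod_cast hm1 z hz)
    exact pow_le_pow_left₀ (inv_nonneg.2 dist_nonneg) (inv_anti₀ h0 (hmle z hz)) _
  have step2 : ∑ z ∈ t, ρ⁻¹ ^ 6 * ((m z : ℝ))⁻¹ ^ 6 =
      ∑ b ∈ u, ((t.filter fun z => m z = b).card : ℝ) * (ρ⁻¹ ^ 6 * ((b : ℝ))⁻¹ ^ 6) := by
    have := Finset.sum_fiberwise_of_maps_to' hmem (fun b : ℕ => ρ⁻¹ ^ 6 * ((b : ℝ))⁻¹ ^ 6)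
    simp only [Finset.sum_const, nsmul_eq_mul] at this
    exact this.symm
  have step3 : ∀ b ∈ u, ((t.filter fun z => m z = b).card : ℝ) ≤ ((2 * (b : ℝ) + 3) * (ρ / η)) ^ 3 := by
    intro b _
    set F := t.filter fun z => m z = b with hF
    have hR : (0 : ℝ) ≤ ((b : ℝ) + 1) * ρ := by positivity
    have hcard := card_le_of_separated_of_dist_le F q hη hR ?_ ?_
    · rw [finrank_euclideanSpace_fin] at hcard
      refine hcard.trans (pow_le_pow_left₀ (by positivity) ?_ 3)
      have h1 : (1 : ℝ) ≤ ρ / η := (one_le_div hη).2 hηρ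
      calc 2 * (((b : ℝ) + 1) * ρ) / η + 1 ≤ 2 * (((b : ℝ) + 1) * ρ) / η + ρ / η := by linarith
        _ = (2 * (b : ℝ) + 3) * (ρ / η) := by ring
    · intro c hc
      obtain ⟨hct, hcb⟩ := Finset.mem_filter.1 hc
      rw [dist_comm]
      have := hmlt c hct
      rw [hcb] at this
      exact this.le
    · intro c hc c' hc' hne
      exact ht' c (Finset.mem_filter.1 hc).1 c' (Finset.mem_filter.1 hc').1 hne
  have step4 : ∀ b ∈ u, ((2 * (b : ℝ) + 3) * (ρ / η)) ^ 3 * (ρ⁻¹ ^ 6 * ((b : ℝ))⁻¹ ^ 6) ≤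
      125 * (η⁻¹ ^ 3 * ρ⁻¹ ^ 3) * ((b : ℝ) ^ 2)⁻¹ := by
    intro b hb
    obtain ⟨z, hz, rfl⟩ := Finset.mem_image.1 hb
    have hb1 : (1 : ℝ) ≤ (m z : ℝ) := by exact_mod_cast hm1 z hz
    set β : ℝ := (m z : ℝ)
    have hβ : 0 < β := by linarith
    have key : (2 * β + 3) ^ 3 * (β⁻¹) ^ 6 ≤ 125 * (β ^ 2)⁻¹ := by
      rw [inv_pow, ← div_eq_mul_inv, ← div_eq_mul_inv,
        div_le_div_iff₀ (by positivity) (by positivity)]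
      have h5 : (2 * β + 3) ^ 3 ≤ (5 * β) ^ 3 :=
        pow_le_pow_left₀ (by positivity) (by linarith) 3
      have h6 : β ^ 5 ≤ β ^ 6 := pow_le_pow_right₀ hb1 (by norm_num)
      nlinarith [mul_le_mul_of_nonneg_right h5 (sq_nonneg β)]
    have hρη : (ρ / η) ^ 3 * ρ⁻¹ ^ 6 = η⁻¹ ^ 3 * ρ⁻¹ ^ 3 := by
      have hρ0 : ρ ≠ 0 := hρ.ne'
      have hη0 : η ≠ 0 := hη.ne'
      field_simp
    calc ((2 * β + 3) * (ρ / η)) ^ 3 * (ρ⁻¹ ^ 6 * (β⁻¹) ^ 6)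
        = ((ρ / η) ^ 3 * ρ⁻¹ ^ 6) * ((2 * β + 3) ^ 3 * (β⁻¹) ^ 6) := by ring
      _ ≤ (η⁻¹ ^ 3 * ρ⁻¹ ^ 3) * (125 * (β ^ 2)⁻¹) := by
          rw [hρη]; exact mul_le_mul_of_nonneg_left key (by positivity)
      _ = 125 * (η⁻¹ ^ 3 * ρ⁻¹ ^ 3) * (β ^ 2)⁻¹ := by ring
  have step5 : ∑ b ∈ u, ((b : ℝ) ^ 2)⁻¹ ≤ 2 := by
    have hsub : u ⊆ Finset.Ioo 0 (u.sup id + 1) := fun b hb => by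
      rw [Finset.mem_Ioo]
      obtain ⟨z, hz, rfl⟩ := Finset.mem_image.1 hb
      exact ⟨hm1 z hz, Nat.lt_succ_of_le (Finset.le_sup (f := id) hb)⟩
    have h2 := sum_Ioo_inv_sq_le (α := ℝ) 0 (u.sup id + 1)
    calc ∑ b ∈ u, ((b : ℝ) ^ 2)⁻¹ ≤ ∑ b ∈ Finset.Ioo 0 (u.sup id + 1), ((b : ℝ) ^ 2)⁻¹ :=
          Finset.sum_le_sum_of_subset_of_nonneg hsub fun b _ _ => by positivity
      _ ≤ 2 := by simpa using h2
  calc ∑ z ∈ t, (dist q z)⁻¹ ^ 6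
      ≤ ∑ b ∈ u, ((t.filter fun z => m z = b).card : ℝ) * (ρ⁻¹ ^ 6 * ((b : ℝ))⁻¹ ^ 6) :=
        step1.trans_eq step2
    _ ≤ ∑ b ∈ u, ((2 * (b : ℝ) + 3) * (ρ / η)) ^ 3 * (ρ⁻¹ ^ 6 * ((b : ℝ))⁻¹ ^ 6) :=
        Finset.sum_le_sum fun b hb => mul_le_mul_of_nonneg_right (step3 b hb) (by positivity)
    _ ≤ ∑ b ∈ u, 125 * (η⁻¹ ^ 3 * ρ⁻¹ ^ 3) * ((b : ℝ) ^ 2)⁻¹ := Finset.sum_le_sum step4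
    _ = 125 * (η⁻¹ ^ 3 * ρ⁻¹ ^ 3) * ∑ b ∈ u, ((b : ℝ) ^ 2)⁻¹ := by rw [Finset.mul_sum]
    _ ≤ 125 * (η⁻¹ ^ 3 * ρ⁻¹ ^ 3) * 2 := mul_le_mul_of_nonneg_left step5 (by positivity)
    _ = 250 * η⁻¹ ^ 3 * ρ⁻¹ ^ 3 := by ring

/-! ## §5 The registered stub `stub_windowFilling` (skeleton v6 of E₂, header verbatim) -/

/-- **`stub_windowFilling`** (registered stub of E₂ `TwelveGapTextureRung`, line «ElasticWindow», skeleton v6): modulo `L12`, an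
allowance-free doubled window `B(p,2ρ)` (`ρ ≥ 9`) that meets the configuration fills space: `(ρ−9)³ ≤ 64·#B(p,ρ)`. -/
theorem stub_windowFilling : Literature.Geometry.DiscreteGeometry.flyspeck_L12 → ∀ (N : ℕ) (y : Fin N → EuclideanSpace ℝ (Fin 3)) (p : EuclideanSpace ℝ (Fin 3)) (ρ : ℝ), 9 ≤ ρ → (∀ i : Fin N, dist (y i) p ≤ 2 * ρ → i ∉ (Finset.univ.filter fun j : Fin N => ∀ d : ℝ, ¬ (3 / 4 ≤ d ∧ d ≤ 6 / 5 ∧ (∀ k l : Fin N, k ≠ l → dist (y k) (y j) ≤ 6 → dist (y l) (y j) ≤ 6 → d ≤ dist (y k) (y l)) ∧ (∀ k : Fin N, dist (y k) (y j) ≤ 5 → 12 ≤ (Finset.univ.filter fun l => l ≠ k ∧ dist (y l) (y k) ≤ (1 + 1 / 60) * d).card)))) → (∃ i : Fin N, dist (y i) p ≤ 2 * ρ) → (ρ - 9) ^ 3 ≤ 64 * ((Finset.univ.filter fun i : Fin N => dist (y i) p ≤ ρ).card : ℝ) := by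
  intro hL12 N y p ρ hρ hAfree hne
  have hA' : ∀ i : Fin N, dist (y i) p ≤ 2 * ρ → ∃ d : ℝ, 3 / 4 ≤ d ∧ d ≤ 6 / 5 ∧
      (∀ k l : Fin N, k ≠ l → dist (y k) (y i) ≤ 6 → dist (y l) (y i) ≤ 6 → d ≤ dist (y k) (y l)) ∧
      (∀ k : Fin N, dist (y k) (y i) ≤ 5 →
        12 ≤ (Finset.univ.filter fun l => l ≠ k ∧ dist (y l) (y k) ≤ (1 + 1 / 60) * d).card) := by
    intro i hi
    have h := hAfree i hi
    simp only [Finset.mem_filter, Finset.mem_univ, true_and, not_forall, not_not] at h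
    exact h
  exact card_window_ge hL12 y p hρ hA' hne

end Summit.AtomisticToContinuum.Crystallization.Theorems.ContactSaturationLadderWindowFilling
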